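import Summits.CriticalPhenomena.Ising3DConformalLimit.Theorems.EnergyNotSigmaSquaredGapForcesFarMergingScreeningUnpinGlue
import Summits.CriticalPhenomena.Ising3DConformalLimit.Theorems.EnergyNotSigmaSquaredGapForcesFarMergingRootOpacityFar

/-!
# The reshaped far end of line `screening-form-lemma-a1`: large-aspect glue
(crux `GapForcesFarMerging`, item stmt-CriticalPhenomena-4468, route `EnergyNotSigmaSquared`; lead seat c2
`prover-line-stmt-CriticalPhenomena-4468-c2-0`; helper file of the registered stub
`stub_farScreening : HittingLowerBound → RootOpacityIO → FarScreeningIO`)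

The wave-2 diagnosis of `stub_hazardRelocation` (…HazardRelocationReduction.lean, p123119) shows that a relocation of the
far ends by constants `1 + δ`, `δ → 0` (the "rate" route, as opposed to up-to-constants comparability of the DROPS at aspect 8)
is only plausible when BOTH far scales have large aspect. The currencies `RootOpacityFarIO` (root opacity at EVERY aspect)
and `HazardRelocationFar` (both far scales beyond `2^{k+A}`, window available) of the Defs part 2 (second append) serve that
route; this file proves its glue and certificate:

* `farScreening_of_unpinFar : HazardRelocationFar → UnpinFlex → RootOpacityFarIO → FarScreeningIO` (registered);
* `gapForcesFarMerging_of_countingFar_floors_hazardRelocationFar_unpinFlex` — with the every-aspect counting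
  `OnePinchScreeningDecay → Floors → RootOpacityFarIO` as an explicit hypothesis, and its specialisation
  `gapForcesFarMerging_of_floors_hazardRelocationFar_unpinFlex : Floors → HazardRelocationFar → UnpinFlex → crux` to the landed
  counting `rootOpacityFar_of_floors` (…RootOpacityFar.lean, p123710).
Pure composition; no lattice input.
-/

noncomputable section

namespace Summit.CriticalPhenomena.Ising3DConformalLimit.GapForcesFarMergingScreening

open scoped symmDiff ENNReal
open MeasureTheory Filter Finset
open Literature.Probability.LatticeModels Literature.Probability.Percolation
open Summit.CriticalPhenomena.Ising3DConformalLimit.Theorems.GapForcesFarMerging.Negative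
  (e₁ e₂ cc2 xR up dn FarMergingShape SinglePinchLawShape crux_iff_shapes)
open Summit.CriticalPhenomena.Ising3DConformalLimit.EnergyNotSigmaSquaredGapForcesFarMerging
  (stub_screeningDecay stub_screeningIdentity stub_farMerging singlePinchLawShape_of_gap
    gapForcesFarMerging_of_floors_farScreening rootOpacityFar_of_floors)

/-- **THE RESHAPED FAR END, large aspect (registered glue)**: the relocation chooses the aspect `2^A` from the drop and the
window constant, the every-aspect root opacity supplies windowed opaque octaves with far scale `m ≥ 2^{k+A}`, un-pinning at
aspect `2^A` screens a fresh probe, and a pigeonhole over the finite family pins one dilated shape. [folklore] -/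
theorem farScreening_of_unpinFar : HazardRelocationFar → UnpinFlex → RootOpacityFarIO → FarScreeningIO := by
  intro hH hU hRO
  obtain ⟨c, θ, hc, hθ, hall⟩ := hRO
  obtain ⟨A, _, c', hc', hH'⟩ := hH c θ hc hθ
  obtain ⟨c'', hc'', j, F, hinj, hU'⟩ := hU A c' θ hc' hθ
  have hk : ∃ᶠ k : ℕ in atTop, ∃ u ∈ F, ∃ᶠ n : ℕ in atTop,
      meanScreening n n 0 (up (2 ^ (k + A))) ((((2 ^ (k - j) : ℕ) : ℤ)) • u) (dn (2 ^ (k + A))) ≤ 1 - c'' := by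
    refine ((hall A).and_eventually (hH'.and hU')).mono ?_
    rintro k ⟨⟨hwin, m, hm, hfrn⟩, hHk, hUk⟩
    refine frequently_exists_mem_finset ?_
    refine (hfrn.and_eventually ((hHk hwin m hm).and (hUk hwin))).mono ?_
    rintro n ⟨hop, hHn, hUn⟩
    exact hUn (hHn hop)
  obtain ⟨u, huF, hku⟩ := frequently_exists_mem_finset hk
  refine ⟨c'', hc'', unpinShape (2 ^ (j + A)) u, hinj u huF, fun L₀ => ?_⟩
  obtain ⟨k, hk0, hkn⟩ := (Filter.frequently_atTop.1 hku) (j + L₀)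
  refine ⟨2 ^ (k - j), ?_, ?_⟩
  · calc L₀ ≤ k - j := by omega
      _ ≤ 2 ^ (k - j) := Nat.lt_two_pow_self.le
  · obtain ⟨h0, h1, h2, h3⟩ := zsmul_unpinShape (2 ^ (j + A)) (2 ^ (k - j)) u
    have hpow : 2 ^ (j + A) * 2 ^ (k - j) = 2 ^ (k + A) := by
      rw [← pow_add]; congr 1; omega
    rw [h0, h1, h2, h3, hpow]
    exact hkn

/-- **The crux modulo the every-aspect counting, the floors and the two large-aspect stubs**: GAP ⟹ one-pinch gap
(`singlePinchLawShape_of_gap`) ⟹ one-pinch screening decay (`stub_screeningDecay`) ⟹ root opacity at every aspect (the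
counting hypothesis) ⟹ far screening (`farScreening_of_unpinFar`) ⟹ far merging (`stub_farMerging`). [folklore] -/
theorem gapForcesFarMerging_of_countingFar_floors_hazardRelocationFar_unpinFlex :
    (OnePinchScreeningDecay → Floors → RootOpacityFarIO) → Floors → HazardRelocationFar → UnpinFlex →
      Summit.CriticalPhenomena.Ising3DConformalLimit.Theses.EnergyNotSigmaSquared.GapForcesFarMerging := by
  intro hRO hF hH hU
  rw [crux_iff_shapes]
  intro hGap
  exact stub_farMerging stub_screeningIdentity
    (farScreening_of_unpinFar hH hU (hRO (stub_screeningDecay stub_screeningIdentity (singlePinchLawShape_of_gap hGap)) hF))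


/-- **The crux modulo the three open stubs of the large-aspect route** (`Floors`, `HazardRelocationFar`, `UnpinFlex`): the
every-aspect counting is the landed `rootOpacityFar_of_floors` (…RootOpacityFar.lean, p123710). [folklore] -/
theorem gapForcesFarMerging_of_floors_hazardRelocationFar_unpinFlex :
    Floors → HazardRelocationFar → UnpinFlex →
      Summit.CriticalPhenomena.Ising3DConformalLimit.Theses.EnergyNotSigmaSquared.GapForcesFarMerging :=
  gapForcesFarMerging_of_countingFar_floors_hazardRelocationFar_unpinFlex rootOpacityFar_of_floors

end Summit.CriticalPhenomena.Ising3DConformalLimit.GapForcesFarMergingScreening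

end
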